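import Summits.ResolutionOfSingularities.ResolutionOfSingularities.Theorems.MarkedTransferCampaignW46MohWindow
import Mathlib.Data.Multiset.DershowitzManna
import HarnessLib

/-!
# [OURS · L1 W4.6, rung (iii)] The cusp staircase — the typed Th. 16.6 procedure on the WHOLE cusp family
# `y^b + u·x^d`, `b ∤ d` (inside and outside the Moh window): regime and rung statements
# (cell res-hironaka, LADDER-RESOLUTION rung L, D-0089; slot W4.6, seat res-L1-s46-pv-5; host route MarkedTransfer,
# `--kind definition --supports stmt-ResolutionOfSingularities-16155 --as helper`)

HONEST FRAMING. Every declaration below is OURS (a campaign definition of the res-hironaka cell, slot W4.6 rung (iii))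
over the shared typed-procedure module `Theorems/MarkedTransferCampaignW46TypedProcedure.lean` (res-L1-type-o1:
`CampaignW46.Regime`, `Step`, `Run`, `Terminates`, `TerminatesNabla`) and this seat's window module
`Theorems/MarkedTransferCampaignW46MohWindow.lean` (`MohWindowAt`, `Regime.mohWindowCurve`); NOTHING here is a
statement of H. Hironaka's manuscript *Resolution of singularities in positive characteristics* (2017-03-23,
[Hironaka2017], lit key `paper:url-3343fd9e678b`) and nothing here asserts that any statement of it holds. The
manuscript enters only through the typed CANDIDATE carriers under `CampaignW46` (row 001 `IdealExponent`, `sing`,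
`transform`; the résumé and centre rule of Th. 16.6 p.84 l.4–8 as typed there). No FACT-LIST premise is used. AI
review is weaker than expert review. STATEMENT-ONLY: no theorem, no `sorry`; the proofs are the companions
`Theorems/MarkedTransferCampaignW46CuspStaircaseProof.lean` (local algebra) and
`Theorems/MarkedTransferCampaignW46CuspStaircaseDescent.lean` (the descent and the rung), same seat.

## Why this file (what kill test K4.6 left standing)

K4.6 (res-L0-k46, kit job j258573, verdict ALIVE) ran the typed procedure on the plane cusps `K_{p,n} = (y^p + xⁿ, p)`,
`p ∤ n`: the typed one-step certificate (Eq. (127)-role) holds exactly on the WINDOW rows `p < n < 2p` and fails at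
step 1 for `n > 2p` — but the PROCEDURE ITSELF terminates on every row after `⌊n/p⌋` point blow-ups
(`KILL-TEST-K4.6.md` §4 rider (iv′): «it is the typed CERTIFICATE that stalls», barrier candidate «CuspStringStall»).
The window files of this seat bank the first half (`MohWindowCurveStepDrop`: `#Sing` drops; boundary sharp at
`d = 2b`, `MarkedTransferCampaignW46MohWindowBoundary`). This file states the second half: on the whole family — the
regime «every singular point carries a cusp germ `y^b + u·x^d` with `u` a unit and `b ∤ d`», imposed at every stage —
the typed Th. 16.6 procedure has NO infinite run, for every notion instance `N` and every `Inv`-reading `Rd`, and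
the role of the one-step certificate is played by OUR invariant: the multiset of cusp indices of the singular points,
which decreases STRICTLY in the Dershowitz–Manna order at every step admitted by the typed centre rule, inside and
outside the window alike (a point of index `d` is replaced by points of index `≤ d − b` over it; off the centre
nothing changes).

## What is defined (namespace `…Theorems.CampaignW46`)

* `CuspShape b d R I` — ring level: `R` (= `𝒪_{Z,ξ}`) is regular local of embedding dimension `2`, and for some
  regular system of parameters `(x, y)` and some unit `u`, `I = (y^b + u·x^d)`.
* `CuspAt b R I` — `CuspShape b d R I` for some `d` with `b ∤ d` (for `b = p`: the rows `y^p + xⁿ`, `p ∤ n`, of K4.6,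
  with arbitrary unit coefficient; the window predicate `MohWindowAt b R I` is the case `b < d < 2b`).
* `cuspIndex b R I` — the least such `d` (`sInf`; `0` by convention when there is none); `cuspIndexAt E ξ` — the cusp
  index of `J_ξ ⊆ 𝒪_{Z,ξ}` for the exponent `E.b`; `cuspMultiset E` — the multiset of the cusp indices of the points
  of `Sing(E)` (`0` by convention when `Sing(E)` is infinite).
* `Regime.cuspCurve` — the regime (DESIGN POINT (REG): imposed on the state `(Z, E)` at EVERY stage): `0 < b`,
  `Sing(E)` is a finite set of closed points, and `J_ξ` is a cusp germ of exponent `E.b` at every `ξ ∈ Sing(E)`.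
* `CuspCurveDescent p K` — OUR replacement of the role of Th. 16.6 (2) / Eq. (127) p.84 l.10–20 in this regime: at
  every step admitted by the typed centre rule from a state in the regime (with `Sing(E′)` finite, as it is at the
  next stage of any run in the regime), `cuspMultiset E′ <_{DM} cuspMultiset E` (Mathlib
  `Multiset.IsDershowitzMannaLT`, a well-founded order on `Multiset ℕ`).
* `CuspCurveTerminates p K` — OUR replacement of the role of the termination clause of Th. 16.13 p.87 l.26–28 in this
  regime: for EVERY `N` and EVERY `Rd`, `CampaignW46.Terminates N Rd Regime.cuspCurve` (the literal-rule notion; on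
  this regime every admitted centre is a closed point and a component of `∇(E)`, and `Terminates ⇒ TerminatesNabla`
  by `RunNabla.toRun` — the ∇-centred corollary is proved in the companion).

As in the window module, quantifying over ALL notion instances is contentful: the proofs use of a run only
`Step.blowup`, `Run.E_succ` and `D ⊆ ∇(E) ⊆ Sing(E)`. Nothing is claimed for `b ∣ d` (for `b = p` and `u = 1` these
are the `p`-th powers `(y + x^{d/p})^p`, `Sing` a curve — K4.6's degenerate controls) nor for surfaces.

## References

* `Theorems/MarkedTransferCampaignW46TypedProcedure.lean` (DESIGN POINTS (REG)/(VAC)), `…MohWindow.lean`,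
  `…MohWindowProof.lean`, `…MohWindowBoundary.lean` (this seat); L/res-L0-k46/KILL-TEST-K4.6.md §3–§4 (kit job
  j258573; ATLAS-RUN j259568: resolution length `⌊n/p⌋`, one singular child per step); plan/RESCUE-SEED.md §1 row W4.6.
* N. Dershowitz, Z. Manna, Proving termination with multiset orderings, Comm. ACM 22 (1979) 465–476 — the order,
  as formalised in Mathlib `Mathlib.Data.Multiset.DershowitzManna`. [folklore]
* H. Hironaka, ms. 2017-03-23, Th. 16.6 p.84 l.4–20, Th. 16.13 p.87 l.26–28, §2.1 p.4 l.35–39, Def. 2.1 p.5 l.2–3 —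
  scope only, under adjudication, not cited as fact. [Hironaka2017]
-/

noncomputable section

set_option linter.dupNamespace false -- mandated namespace of this single-conjunct summit

open CategoryTheory AlgebraicGeometry TopologicalSpace IsLocalRing

namespace Summit.ResolutionOfSingularities.ResolutionOfSingularities.Theorems

namespace CampaignW46

open Literature.AlgebraicGeometry.Resolution
open Literature.AlgebraicGeometry.Hironaka2017.S02Preliminaries
open Literature.AlgebraicGeometry.Hironaka2017.Datum

universe u

/-! ## Cusp germs (ring level) -/

/-- [OURS · L1 W4.6 rung (iii)] replaces the role of the hypothesis «plane cusp `y^b = u·x^d`» READ IN THE STALK at a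
singular point, with BOTH exponents named; NOT a statement of the manuscript. For a local ring `R` (= `𝒪_{Z,ξ}`),
an ideal `I ⊆ R` (= `J_ξ`) and `b d : ℕ`: `R` is a regular local ring of embedding dimension `2`, and for some
regular system of parameters `(x, y)` of `R` and some unit `u`, `I = (y^b + u·x^d)`. [folklore] -/
def CuspShape (b d : ℕ) (R : Type u) [CommRing R] [IsLocalRing R] (I : Ideal R) : Prop :=
  IsRegularLocalRing R ∧ (maximalIdeal R).spanFinrank = 2 ∧
    ∃ x y : R, Ideal.span {x, y} = maximalIdeal R ∧ ∃ u : R, IsUnit u ∧ I = Ideal.span {y ^ b + u * x ^ d}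

/-- [OURS · L1 W4.6 rung (iii)] replaces the role of the hypothesis «`J_ξ` is a cusp germ of exponent `b` off the
`p`-th-power locus» (K4.6's registered family `y^p + xⁿ`, `p ∤ n`, with arbitrary unit coefficient); NOT a statement of
the manuscript: `CuspShape b d R I` for some `d` NOT divisible by `b`. The window germs (`MohWindowAt b R I`,
`b < d < 2b`) are the special case proved in the companion (`MohWindowAt.cuspAt`). [folklore] -/
def CuspAt (b : ℕ) (R : Type u) [CommRing R] [IsLocalRing R] (I : Ideal R) : Prop :=
  ∃ d : ℕ, ¬ b ∣ d ∧ CuspShape b d R I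

/-- [OURS · L1 W4.6 rung (iii)] the CUSP INDEX of `I ⊆ R` for the exponent `b`: the least `d` with `b ∤ d` and
`CuspShape b d R I` (`sInf` over `ℕ`; `0` by convention when `I` is not a cusp germ); for `y^p + xⁿ`, `p ∤ n`, the
exponent `n` is admissible, so the index is at most `n` (companion: at a point of `Sing(E)` every admissible `d`
exceeds `b`, `Cusp.lt_of_cuspShape_of_le_pow`). NOT a statement of the manuscript. [folklore] -/
def cuspIndex (b : ℕ) (R : Type u) [CommRing R] [IsLocalRing R] (I : Ideal R) : ℕ :=
  sInf {d : ℕ | ¬ b ∣ d ∧ CuspShape b d R I}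

/-! ## The regime, the invariant and the rung statements -/

variable {n : ℕ} {p : ℕ} [Fact p.Prime] {K : Type u} [Field K] [CharP K p]

/-- [OURS · L1 W4.6 rung (iii)] the cusp index of `J_ξ ⊆ 𝒪_{Z,ξ}` for the exponent `b` of `E = (J, b)` (row 001
`stalkIdeal`). NOT a statement of the manuscript. [folklore] -/
def cuspIndexAt {Z : Scheme.{u}} (E : IdealExponent Z) (ξ : Z) : ℕ :=
  cuspIndex E.b (Z.presheaf.stalk ξ) (stalkIdeal E.J ξ)

open scoped Classical in
/-- [OURS · L1 W4.6 rung (iii)] OUR INVARIANT of the state — the multiset of the cusp indices of the singular points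
`ξ ∈ Sing(E)` (row 001 `IdealExponent.sing`), an element of `Multiset ℕ` ordered by Dershowitz–Manna; `0` by
convention when `Sing(E)` is infinite (never the case in the regime). NOT a statement of the manuscript. [folklore] -/
def cuspMultiset {Z : Scheme.{u}} (E : IdealExponent Z) : Multiset ℕ :=
  if h : E.sing.Finite then h.toFinset.val.map (cuspIndexAt E) else 0

/-- [OURS · L1 W4.6 rung (iii)] **Regime «cusp staircase»** — replaces the role of the restriction of RESCUE-SEED
W4.6 (iii) to K4.6's whole registered family, read on the state `(Z, E)` of the typed Th. 16.6 procedure at EVERY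
stage (DESIGN POINT (REG)); NOT a statement of the manuscript: the exponent `b` of `E` is positive (p.6 l.37–38
«positive to begin with», row 001 `IsStandard`), `Sing(E)` is a finite set of closed points of `Z`, and at every
`ξ ∈ Sing(E)` the stalk `J_ξ ⊆ 𝒪_{Z,ξ}` is a cusp germ of exponent `E.b` (`CuspAt`). Contains `Regime.mohWindowCurve`
at every singular state (companion `Regime.cuspCurve_of_mohWindowCurve`). [folklore] -/
def Regime.cuspCurve : Regime p K := fun A E =>
  0 < E.b ∧ E.sing.Finite ∧ E.sing ⊆ Literature.AlgebraicGeometry.Hironaka2017.S02Preliminaries.closedPoints A.Z ∧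
    ∀ ξ ∈ E.sing, CuspAt E.b (A.Z.presheaf.stalk ξ) (stalkIdeal E.J ξ)

/-- [OURS · L1 W4.6 rung (iii)] replaces the role of Th. 16.6 (2) / Eq. (127) p.84 l.10–20 («strict decrease at every
step») for the typed procedure on the cusp staircase, with OUR invariant `cuspMultiset` in place of the résumé
string; NOT a statement of the manuscript: for every notion instance `N`, every state `(A, E, R)` in
`Regime.cuspCurve` and every step `s` admitted by the typed centre rule whose transform has finitely many singular
points, `cuspMultiset E′ <_{DM} cuspMultiset E` (Mathlib `Multiset.IsDershowitzMannaLT`). Holds inside AND outside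
the Moh window (companion `cuspCurveDescent_holds`), whereas `#Sing` drops only inside (`MohWindowCurveStepDrop`,
boundary `…MohWindowBoundary`). [folklore] -/
def CuspCurveDescent (p : ℕ) [Fact p.Prime] (K : Type u) [Field K] [CharP K p] : Prop :=
  ∀ (n : ℕ) (N : Notions.{u} n) (A A' : AmbientDatum p K) (E : IdealExponent A.Z) (R : Resume N A E)
    (s : Step R A'), Regime.cuspCurve (p := p) (K := K) A E → s.E'.sing.Finite →
      Multiset.IsDershowitzMannaLT (cuspMultiset s.E') (cuspMultiset E)

/-- [OURS · L1 W4.6 rung (iii)] **The rung** — replaces the role of the termination clause of Th. 16.13 p.87 l.26–28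
(«repeatedly but finitely many times») for the TYPED Th. 16.6 procedure restricted to the cusp staircase; NOT a
statement of the manuscript: for EVERY notion instance `N` and EVERY `Inv`-reading `Rd` there is no infinite run of
the typed procedure all of whose stages lie in `Regime.cuspCurve` (`CampaignW46.Terminates`; the ∇-centred
`TerminatesNabla` follows, companion `terminatesNabla_cuspCurve`). [folklore] -/
def CuspCurveTerminates (p : ℕ) [Fact p.Prime] (K : Type u) [Field K] [CharP K p] : Prop :=
  ∀ (n : ℕ) (N : Notions.{u} n) (Rd : Reading p K N), Terminates N Rd (Regime.cuspCurve (p := p) (K := K))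

end CampaignW46

end Summit.ResolutionOfSingularities.ResolutionOfSingularities.Theorems

end
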